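import Summits.KontsevichZagierPeriods.KontsevichZagierPeriods.Theorems.HurwitzMicroSectorsNormalFormPrinciplePiPowersKernel
import Summits.KontsevichZagierPeriods.KontsevichZagierPeriods.Theorems.HurwitzMicroSectorsNormalFormPrincipleM4EtaTwoZetaBox

/-!
# `NormalFormPrinciple` (stmt-KontsevichZagierPeriods-3869), line `SketchIdeator1` —
# leaf `stub_boxRigidity`: the level-two family `[□⁴, 1/((1+xy)(1−Π))]` joins the `π`-powers kernel

Pure proof file (lead seat c9; `--supports` the crux). Every representative of the family
`[□⁴, 1/((1 + x₀x₁)(1 − Π))]` (value `13ζ(4)/16`) is congruent modulo `KZ.relations` to the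
diagonal even box `[□⁴, (13/16)/(1 − Π)]` (cubical chart onto `aaab − acab`, `16[acab] − 3[aaab]`
from `m4_level2_acab`, `[□⁴,1/(1−Π)] ≡ [aaab]`, `16·[W] ≡ 13·[Z4]` by integrand additivity, division by
`16` through the scaling move); hence, by the sup argument, Conjecture 1 holds unconditionally in kernel
form on the subgroup of `piPowers_mem_relations_of_eval_eq_zero` extended by this family.
References: M. Kontsevich, D. Zagier, *Periods* (2001), §1.2 (Conjecture 1). No definitions are introduced.
-/

noncomputable section

open MeasureTheory Set
open Literature.NumberTheory.Transcendental Literature.NumberTheory.Transcendental.KZ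
open Summit.KontsevichZagierPeriods.MzvKernelInKZ.Negative (mem_relations_of_nsmul_mem)
open Summit.KontsevichZagierPeriods.HyperbolicBloch.OffTetraSectorKernel
  (aff_orbit_of_sub_sum_zsmul_mem_relations)

namespace Summit.KontsevichZagierPeriods.HurwitzMicroSectors.NormalFormPrinciple.PiBox.M3

/-- **The family `[□⁴, 1/((1+xy)(1−Π))]` joins the `π`-powers kernel** (lead seat c9): Conjecture 1
holds unconditionally, in kernel form, on the subgroup generated by the generators of
`piPowers_mem_relations_of_eval_eq_zero` together with this level-two family (each representative is
congruent to the even-zeta box `[□⁴, (13/16)/(1 − Π)]`). [cite: KontsevichZagier2001, §1.2 Conjecture 1] -/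
theorem piPowersEta_mem_relations_of_eval_eq_zero {c : FormalRep}
    (hc : c ∈ AddSubgroup.closure
      (({y : FormalRep | ∃ (k : ℕ) (S : Finset ℕ) (coef : ℕ → ℝ) (N : IntegralRep (2 * (k + 1))),
          (∀ i ∈ S, IsAlgebraic ℚ (coef i)) ∧ N.domain = {x | ∀ i, x i ∈ Set.Ioo (0:ℝ) 1} ∧
          EqOn N.integrand (fun x => (∑ i ∈ S, coef i * (∏ l, x l) ^ i) / (1 - ∏ l, x l)) N.domain ∧
          y = of N} ∪
       {y : FormalRep | ∃ (w : ℕ) (c : ℝ) (N : IntegralRep w), IsAlgebraic ℚ c ∧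
          N.domain = {x | ∀ i, x i ∈ Set.Ioo (0:ℝ) 1} ∧ EqOn N.integrand (fun _ => c) N.domain ∧ y = of N} ∪
       {y : FormalRep | ∃ (r : ℝ) (Z : IntegralRep 0), IsAlgebraic ℚ r ∧ Z.domain = Set.univ ∧
          (Z.integrand = fun _ => r) ∧ y = of Z} ∪
       {y : FormalRep | ∃ (m : ℕ) (p : MvPolynomial (Fin m) ℚ) (N : IntegralRep m),
          N.domain = {x | ∀ i, x i ∈ Set.Ioo (0:ℝ) 1} ∧
          EqOn N.integrand (fun x => (MvPolynomial.aeval x p : ℝ)) N.domain ∧ y = of N} ∪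
       {y : FormalRep | ∃ (P : MvPolynomial (Fin 2) ℚ) (N : IntegralRep 2),
          N.domain = {x | ∀ i, x i ∈ Set.Ioo (0:ℝ) 1} ∧
          EqOn N.integrand (fun x => (MvPolynomial.aeval x P : ℝ) / (1 - x 0 * x 1)) N.domain ∧
          y = of N} ∪
       {y : FormalRep | ∃ N : IntegralRep 2, N.domain = {x | ∀ i, x i ∈ Set.Ioo (0:ℝ) 1} ∧
          EqOn N.integrand (fun x => 1 / (1 + x 0 * x 1)) N.domain ∧ y = of N} ∪
       {y : FormalRep | ∃ N : IntegralRep 2, N.domain = {x | ∀ i, x i ∈ Set.Ioo (0:ℝ) 1} ∧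
          EqOn N.integrand (fun x => 4 * x 0 * x 1 / (1 - x 0 ^ 2 * x 1 ^ 2)) N.domain ∧ y = of N} ∪
       {y : FormalRep | ∃ N : IntegralRep 2, N.domain = {x | ∀ i, x i ∈ Set.Ioo (0:ℝ) 1} ∧
          EqOn N.integrand (fun x => 1 / (-1 - x 0 * x 1)) N.domain ∧ y = of N} ∪
       {y : FormalRep | ∃ N : IntegralRep 4, N.domain = {x | ∀ i, x i ∈ Set.Ioo (0:ℝ) 1} ∧
          EqOn N.integrand (fun x => 1 / (1 - x 0 * x 1 * x 2 * x 3)) N.domain ∧ y = of N} ∪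
       {y : FormalRep | ∃ N : IntegralRep 4, N.domain = {x | ∀ i, x i ∈ Set.Ioo (0:ℝ) 1} ∧
          EqOn N.integrand (fun x => 1 / (1 + x 0 * x 1 * x 2 * x 3)) N.domain ∧ y = of N} ∪
       {y : FormalRep | ∃ N : IntegralRep 4, N.domain = {x | ∀ i, x i ∈ Set.Ioo (0:ℝ) 1} ∧
          EqOn N.integrand (fun x => 1 / ((1 - x 0 * x 1) * (1 - x 0 * x 1 * x 2 * x 3))) N.domain ∧ y = of N} ∪
       {y : FormalRep | ∃ N : IntegralRep 4, N.domain = {x | ∀ i, x i ∈ Set.Ioo (0:ℝ) 1} ∧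
          EqOn N.integrand (fun x => 1 / ((1 - x 0 * x 1 * x 2) * (1 - x 0 * x 1 * x 2 * x 3))) N.domain ∧ y = of N} ∪
       {y : FormalRep | ∃ N : IntegralRep 4, N.domain = {x | ∀ i, x i ∈ Set.Ioo (0:ℝ) 1} ∧
          EqOn N.integrand (fun x => 1 / ((1 - x 0 * x 1) * (1 - x 2 * x 3))) N.domain ∧ y = of N} ∪
       {y : FormalRep | ∃ N : IntegralRep 4, N.domain = {x | ∀ i, x i ∈ Set.Ioo (0:ℝ) 1} ∧
          EqOn N.integrand (fun x => 1 / ((1 - x 0 * x 1) * (1 + x 2 * x 3))) N.domain ∧ y = of N} ∪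
       {y : FormalRep | ∃ N : IntegralRep 4, N.domain = {x | ∀ i, x i ∈ Set.Ioo (0:ℝ) 1} ∧
          EqOn N.integrand (fun x => 1 / ((1 + x 0 * x 1) * (1 + x 2 * x 3))) N.domain ∧ y = of N}) ∪
       {y : FormalRep | ∃ N : IntegralRep 4, N.domain = {x | ∀ i, x i ∈ Set.Ioo (0:ℝ) 1} ∧
          EqOn N.integrand (fun x => 1 / ((1 + x 0 * x 1) * (1 - x 0 * x 1 * x 2 * x 3))) N.domain ∧
          y = of N}))
    (hv : eval c = 0) : c ∈ relations := by
  classical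
  obtain ⟨Z4, C1, Z3, hZ4d, hZ4i, -, hC1d, hC1i, -, -, -⟩ := m4r4_exists_refs
  obtain ⟨-, AC, -, -, AAAB, -, -, -, -, ⟨hACd, hACi⟩, -, -, ⟨hAAABd, hAAABi⟩, -, -, -, -, -, -, -, -,
    -, -⟩ := m4r4_exists_words C1 hC1d hC1i
  obtain ⟨ACAB, hACABd, hACABi⟩ : ∃ T : IntegralRep 4, T.domain = {t | 0 < t 3 ∧ t 3 < t 2 ∧ t 2 < t 1 ∧ t 1 < t 0 ∧ t 0 < 1} ∧
      (T.integrand = fun t => 1 / t 0 * (1 / (1 + t 1)) * (1 / t 2) * (1 / (1 - t 3))) :=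
    m4_exists_wordRep4 (fun u => 1 / u) (fun u => 1 / (1 + u)) (fun u => 1 / u) (fun u => 1 / (1 - u))
      (Or.inl rfl) (Or.inr (Or.inr rfl)) (Or.inl rfl) (Or.inl rfl)
  have k := m4_level2_acab AC hACd hACi AAAB hAAABd hAAABi ACAB hACABd hACABi
  obtain ⟨V, hVd, hVi, hVsplit⟩ := m4e_exists_V AAAB hAAABd hAAABi ACAB hACABd hACABi
  -- the even-zeta box `W = [□⁴, (13/16)/(1 − Π)]` and `16[W] ≡ 13[Z4] ≡ 13[aaab]`
  set W : IntegralRep 4 := Z4.constMul (((13/16 : ℚ)) : ℝ) (isAlgebraic_rat ℚ _) with hW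
  have hWmem : of W ∈ AddSubgroup.closure ({y : FormalRep | ∃ (k : ℕ) (S : Finset ℕ) (coef : ℕ → ℝ) (N : IntegralRep (2 * (k + 1))),
          (∀ i ∈ S, IsAlgebraic ℚ (coef i)) ∧ N.domain = {x | ∀ i, x i ∈ Set.Ioo (0:ℝ) 1} ∧
          EqOn N.integrand (fun x => (∑ i ∈ S, coef i * (∏ l, x l) ^ i) / (1 - ∏ l, x l)) N.domain ∧
          y = of N} ∪
       {y : FormalRep | ∃ (w : ℕ) (c : ℝ) (N : IntegralRep w), IsAlgebraic ℚ c ∧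
          N.domain = {x | ∀ i, x i ∈ Set.Ioo (0:ℝ) 1} ∧ EqOn N.integrand (fun _ => c) N.domain ∧ y = of N} ∪
       {y : FormalRep | ∃ (r : ℝ) (Z : IntegralRep 0), IsAlgebraic ℚ r ∧ Z.domain = Set.univ ∧
          (Z.integrand = fun _ => r) ∧ y = of Z} ∪
       {y : FormalRep | ∃ (m : ℕ) (p : MvPolynomial (Fin m) ℚ) (N : IntegralRep m),
          N.domain = {x | ∀ i, x i ∈ Set.Ioo (0:ℝ) 1} ∧
          EqOn N.integrand (fun x => (MvPolynomial.aeval x p : ℝ)) N.domain ∧ y = of N} ∪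
       {y : FormalRep | ∃ (P : MvPolynomial (Fin 2) ℚ) (N : IntegralRep 2),
          N.domain = {x | ∀ i, x i ∈ Set.Ioo (0:ℝ) 1} ∧
          EqOn N.integrand (fun x => (MvPolynomial.aeval x P : ℝ) / (1 - x 0 * x 1)) N.domain ∧
          y = of N} ∪
       {y : FormalRep | ∃ N : IntegralRep 2, N.domain = {x | ∀ i, x i ∈ Set.Ioo (0:ℝ) 1} ∧
          EqOn N.integrand (fun x => 1 / (1 + x 0 * x 1)) N.domain ∧ y = of N} ∪
       {y : FormalRep | ∃ N : IntegralRep 2, N.domain = {x | ∀ i, x i ∈ Set.Ioo (0:ℝ) 1} ∧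
          EqOn N.integrand (fun x => 4 * x 0 * x 1 / (1 - x 0 ^ 2 * x 1 ^ 2)) N.domain ∧ y = of N} ∪
       {y : FormalRep | ∃ N : IntegralRep 2, N.domain = {x | ∀ i, x i ∈ Set.Ioo (0:ℝ) 1} ∧
          EqOn N.integrand (fun x => 1 / (-1 - x 0 * x 1)) N.domain ∧ y = of N} ∪
       {y : FormalRep | ∃ N : IntegralRep 4, N.domain = {x | ∀ i, x i ∈ Set.Ioo (0:ℝ) 1} ∧
          EqOn N.integrand (fun x => 1 / (1 - x 0 * x 1 * x 2 * x 3)) N.domain ∧ y = of N} ∪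
       {y : FormalRep | ∃ N : IntegralRep 4, N.domain = {x | ∀ i, x i ∈ Set.Ioo (0:ℝ) 1} ∧
          EqOn N.integrand (fun x => 1 / (1 + x 0 * x 1 * x 2 * x 3)) N.domain ∧ y = of N} ∪
       {y : FormalRep | ∃ N : IntegralRep 4, N.domain = {x | ∀ i, x i ∈ Set.Ioo (0:ℝ) 1} ∧
          EqOn N.integrand (fun x => 1 / ((1 - x 0 * x 1) * (1 - x 0 * x 1 * x 2 * x 3))) N.domain ∧ y = of N} ∪
       {y : FormalRep | ∃ N : IntegralRep 4, N.domain = {x | ∀ i, x i ∈ Set.Ioo (0:ℝ) 1} ∧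
          EqOn N.integrand (fun x => 1 / ((1 - x 0 * x 1 * x 2) * (1 - x 0 * x 1 * x 2 * x 3))) N.domain ∧ y = of N} ∪
       {y : FormalRep | ∃ N : IntegralRep 4, N.domain = {x | ∀ i, x i ∈ Set.Ioo (0:ℝ) 1} ∧
          EqOn N.integrand (fun x => 1 / ((1 - x 0 * x 1) * (1 - x 2 * x 3))) N.domain ∧ y = of N} ∪
       {y : FormalRep | ∃ N : IntegralRep 4, N.domain = {x | ∀ i, x i ∈ Set.Ioo (0:ℝ) 1} ∧
          EqOn N.integrand (fun x => 1 / ((1 - x 0 * x 1) * (1 + x 2 * x 3))) N.domain ∧ y = of N} ∪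
       {y : FormalRep | ∃ N : IntegralRep 4, N.domain = {x | ∀ i, x i ∈ Set.Ioo (0:ℝ) 1} ∧
          EqOn N.integrand (fun x => 1 / ((1 + x 0 * x 1) * (1 + x 2 * x 3))) N.domain ∧ y = of N}) := by
    refine AddSubgroup.subset_closure ?_
    simp only [mem_union, mem_setOf_eq]
    refine Or.inl (Or.inl (Or.inl (Or.inl (Or.inl (Or.inl (Or.inl (Or.inl (Or.inl (Or.inl (Or.inl (Or.inl
      (Or.inl (Or.inl ⟨1, {0}, fun _ => (((13/16 : ℚ)) : ℝ), W, fun _ _ => isAlgebraic_rat ℚ _, by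
        rw [hW, IntegralRep.domain_constMul, hZ4d], fun x _ => ?_, rfl⟩)))))))))))))
    rw [hW, IntegralRep.integrand_constMul, hZ4i]
    simp only [Finset.sum_singleton, pow_zero, mul_one]
    show (((13/16 : ℚ)) : ℝ) * (1 / (1 - x 0 * x 1 * x 2 * x 3)) = (((13/16 : ℚ)) : ℝ) / (1 - ∏ l : Fin 4, x l)
    rw [Fin.prod_univ_four, mul_one_div]
  have hWZ : (16:ℤ) • of W - (13:ℤ) • of Z4 ∈ relations := by
    have h1 := aff_orbit_of_sub_sum_zsmul_mem_relations (Finset.univ : Finset (Fin 1))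
      ![Z4] ![13] (W.constMul ((16:ℕ):ℝ) (isAlgebraic_nat 16)) (fun i _ => by
        fin_cases i
        show Z4.domain = (W.constMul ((16:ℕ):ℝ) (isAlgebraic_nat 16)).domain
        rw [IntegralRep.domain_constMul, hW, IntegralRep.domain_constMul]) fun x _ => by
        rw [IntegralRep.integrand_constMul, hW, IntegralRep.integrand_constMul]
        simp only [Finset.univ_unique, Fin.default_eq_zero, Finset.sum_singleton,
          Matrix.cons_val_fin_one]
        push_cast; ring
    have h2 := IntegralRep.of_constMul_nat_sub_nsmul_mem_relations W 16
    have e : (16:ℤ) • of W - (13:ℤ) • of Z4 =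
        (of (W.constMul ((16:ℕ):ℝ) (isAlgebraic_nat 16)) - ∑ i ∈ (Finset.univ : Finset (Fin 1)),
          (![(13:ℤ)] i) • of (![Z4] i)) - (of (W.constMul ((16:ℕ):ℝ) (isAlgebraic_nat 16)) - (16:ℕ) • of W) := by
      simp only [Finset.univ_unique, Fin.default_eq_zero, Finset.sum_singleton, Matrix.cons_val_fin_one]
      abel
    rw [e]
    exact relations.sub_mem h1 h2
  have cZ : of Z4 - (1:ℕ) • of AAAB ∈ relations := by
    refine m4z_box_sub_nsmul_word 1 _ Z4 AAAB hZ4d hAAABd hAAABi fun x hx => ?_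
    rw [hZ4d] at hx
    obtain ⟨h0, h1, h2, h3, -, -, hP⟩ := m4z_box_facts hx
    rw [hZ4i]
    simp only [Matrix.cons_val_zero, Matrix.cons_val_one, Matrix.head_cons, Matrix.cons_val_two,
      Matrix.tail_cons, Matrix.cons_val_three]
    have hP' : 1 - x 0 * x 1 * x 2 * x 3 ≠ 0 := by linarith
    push_cast
    field_simp
  -- every representative of the new family is congruent to `W`
  have hnew : ∀ N : IntegralRep 4, N.domain = {x | ∀ i, x i ∈ Set.Ioo (0:ℝ) 1} →
      EqOn N.integrand (fun x => 1 / ((1 + x 0 * x 1) * (1 - x 0 * x 1 * x 2 * x 3))) N.domain →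
      of N - of W ∈ relations := by
    intro N hNd hNi
    have c1 : of N - (1:ℕ) • of V ∈ relations := by
      refine m4z_box_sub_nsmul_word 1 _ N V hNd hVd hVi fun x hx => ?_
      rw [hNd] at hx
      obtain ⟨h0, h1, h2, h3, h01, -, hP⟩ := m4z_box_facts hx
      rw [hNi (hNd ▸ hx)]
      simp only [Matrix.cons_val_zero, Matrix.cons_val_one, Matrix.head_cons, Matrix.cons_val_two,
        Matrix.tail_cons, Matrix.cons_val_three]
      have hP' : 1 - x 0 * x 1 * x 2 * x 3 ≠ 0 := by linarith
      push_cast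
      field_simp
    refine mem_relations_of_nsmul_mem (by norm_num : 0 < 16) ?_
    have e : (16:ℕ) • (of N - of W) = (16:ℕ) • (of N - (1:ℕ) • of V)
        + (16:ℕ) • (of V - ((1:ℤ) • of AAAB + (-1:ℤ) • of ACAB)) - ((16:ℤ) • of ACAB - (3:ℤ) • of AAAB)
        + (13:ℕ) • ((1:ℕ) • of AAAB - of Z4) - ((16:ℤ) • of W - (13:ℤ) • of Z4) := by
      simp only [one_smul, neg_smul, smul_add, smul_sub, smul_neg]
      abel
    rw [e]
    refine relations.sub_mem (relations.add_mem (relations.sub_mem (relations.add_mem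
      (relations.nsmul_mem c1 _) (relations.nsmul_mem hVsplit _)) k) (relations.nsmul_mem ?_ _)) hWZ
    have e' : (1:ℕ) • of AAAB - of Z4 = -(of Z4 - (1:ℕ) • of AAAB) := by abel
    rw [e']
    exact relations.neg_mem cZ
  -- the sup argument
  have hle : AddSubgroup.closure (({y : FormalRep | ∃ (k : ℕ) (S : Finset ℕ) (coef : ℕ → ℝ) (N : IntegralRep (2 * (k + 1))),
          (∀ i ∈ S, IsAlgebraic ℚ (coef i)) ∧ N.domain = {x | ∀ i, x i ∈ Set.Ioo (0:ℝ) 1} ∧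
          EqOn N.integrand (fun x => (∑ i ∈ S, coef i * (∏ l, x l) ^ i) / (1 - ∏ l, x l)) N.domain ∧
          y = of N} ∪
       {y : FormalRep | ∃ (w : ℕ) (c : ℝ) (N : IntegralRep w), IsAlgebraic ℚ c ∧
          N.domain = {x | ∀ i, x i ∈ Set.Ioo (0:ℝ) 1} ∧ EqOn N.integrand (fun _ => c) N.domain ∧ y = of N} ∪
       {y : FormalRep | ∃ (r : ℝ) (Z : IntegralRep 0), IsAlgebraic ℚ r ∧ Z.domain = Set.univ ∧
          (Z.integrand = fun _ => r) ∧ y = of Z} ∪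
       {y : FormalRep | ∃ (m : ℕ) (p : MvPolynomial (Fin m) ℚ) (N : IntegralRep m),
          N.domain = {x | ∀ i, x i ∈ Set.Ioo (0:ℝ) 1} ∧
          EqOn N.integrand (fun x => (MvPolynomial.aeval x p : ℝ)) N.domain ∧ y = of N} ∪
       {y : FormalRep | ∃ (P : MvPolynomial (Fin 2) ℚ) (N : IntegralRep 2),
          N.domain = {x | ∀ i, x i ∈ Set.Ioo (0:ℝ) 1} ∧
          EqOn N.integrand (fun x => (MvPolynomial.aeval x P : ℝ) / (1 - x 0 * x 1)) N.domain ∧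
          y = of N} ∪
       {y : FormalRep | ∃ N : IntegralRep 2, N.domain = {x | ∀ i, x i ∈ Set.Ioo (0:ℝ) 1} ∧
          EqOn N.integrand (fun x => 1 / (1 + x 0 * x 1)) N.domain ∧ y = of N} ∪
       {y : FormalRep | ∃ N : IntegralRep 2, N.domain = {x | ∀ i, x i ∈ Set.Ioo (0:ℝ) 1} ∧
          EqOn N.integrand (fun x => 4 * x 0 * x 1 / (1 - x 0 ^ 2 * x 1 ^ 2)) N.domain ∧ y = of N} ∪
       {y : FormalRep | ∃ N : IntegralRep 2, N.domain = {x | ∀ i, x i ∈ Set.Ioo (0:ℝ) 1} ∧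
          EqOn N.integrand (fun x => 1 / (-1 - x 0 * x 1)) N.domain ∧ y = of N} ∪
       {y : FormalRep | ∃ N : IntegralRep 4, N.domain = {x | ∀ i, x i ∈ Set.Ioo (0:ℝ) 1} ∧
          EqOn N.integrand (fun x => 1 / (1 - x 0 * x 1 * x 2 * x 3)) N.domain ∧ y = of N} ∪
       {y : FormalRep | ∃ N : IntegralRep 4, N.domain = {x | ∀ i, x i ∈ Set.Ioo (0:ℝ) 1} ∧
          EqOn N.integrand (fun x => 1 / (1 + x 0 * x 1 * x 2 * x 3)) N.domain ∧ y = of N} ∪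
       {y : FormalRep | ∃ N : IntegralRep 4, N.domain = {x | ∀ i, x i ∈ Set.Ioo (0:ℝ) 1} ∧
          EqOn N.integrand (fun x => 1 / ((1 - x 0 * x 1) * (1 - x 0 * x 1 * x 2 * x 3))) N.domain ∧ y = of N} ∪
       {y : FormalRep | ∃ N : IntegralRep 4, N.domain = {x | ∀ i, x i ∈ Set.Ioo (0:ℝ) 1} ∧
          EqOn N.integrand (fun x => 1 / ((1 - x 0 * x 1 * x 2) * (1 - x 0 * x 1 * x 2 * x 3))) N.domain ∧ y = of N} ∪
       {y : FormalRep | ∃ N : IntegralRep 4, N.domain = {x | ∀ i, x i ∈ Set.Ioo (0:ℝ) 1} ∧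
          EqOn N.integrand (fun x => 1 / ((1 - x 0 * x 1) * (1 - x 2 * x 3))) N.domain ∧ y = of N} ∪
       {y : FormalRep | ∃ N : IntegralRep 4, N.domain = {x | ∀ i, x i ∈ Set.Ioo (0:ℝ) 1} ∧
          EqOn N.integrand (fun x => 1 / ((1 - x 0 * x 1) * (1 + x 2 * x 3))) N.domain ∧ y = of N} ∪
       {y : FormalRep | ∃ N : IntegralRep 4, N.domain = {x | ∀ i, x i ∈ Set.Ioo (0:ℝ) 1} ∧
          EqOn N.integrand (fun x => 1 / ((1 + x 0 * x 1) * (1 + x 2 * x 3))) N.domain ∧ y = of N}) ∪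
       {y : FormalRep | ∃ N : IntegralRep 4, N.domain = {x | ∀ i, x i ∈ Set.Ioo (0:ℝ) 1} ∧
          EqOn N.integrand (fun x => 1 / ((1 + x 0 * x 1) * (1 - x 0 * x 1 * x 2 * x 3))) N.domain ∧
          y = of N}) ≤
      AddSubgroup.closure ({y : FormalRep | ∃ (k : ℕ) (S : Finset ℕ) (coef : ℕ → ℝ) (N : IntegralRep (2 * (k + 1))),
          (∀ i ∈ S, IsAlgebraic ℚ (coef i)) ∧ N.domain = {x | ∀ i, x i ∈ Set.Ioo (0:ℝ) 1} ∧
          EqOn N.integrand (fun x => (∑ i ∈ S, coef i * (∏ l, x l) ^ i) / (1 - ∏ l, x l)) N.domain ∧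
          y = of N} ∪
       {y : FormalRep | ∃ (w : ℕ) (c : ℝ) (N : IntegralRep w), IsAlgebraic ℚ c ∧
          N.domain = {x | ∀ i, x i ∈ Set.Ioo (0:ℝ) 1} ∧ EqOn N.integrand (fun _ => c) N.domain ∧ y = of N} ∪
       {y : FormalRep | ∃ (r : ℝ) (Z : IntegralRep 0), IsAlgebraic ℚ r ∧ Z.domain = Set.univ ∧
          (Z.integrand = fun _ => r) ∧ y = of Z} ∪
       {y : FormalRep | ∃ (m : ℕ) (p : MvPolynomial (Fin m) ℚ) (N : IntegralRep m),
          N.domain = {x | ∀ i, x i ∈ Set.Ioo (0:ℝ) 1} ∧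
          EqOn N.integrand (fun x => (MvPolynomial.aeval x p : ℝ)) N.domain ∧ y = of N} ∪
       {y : FormalRep | ∃ (P : MvPolynomial (Fin 2) ℚ) (N : IntegralRep 2),
          N.domain = {x | ∀ i, x i ∈ Set.Ioo (0:ℝ) 1} ∧
          EqOn N.integrand (fun x => (MvPolynomial.aeval x P : ℝ) / (1 - x 0 * x 1)) N.domain ∧
          y = of N} ∪
       {y : FormalRep | ∃ N : IntegralRep 2, N.domain = {x | ∀ i, x i ∈ Set.Ioo (0:ℝ) 1} ∧
          EqOn N.integrand (fun x => 1 / (1 + x 0 * x 1)) N.domain ∧ y = of N} ∪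
       {y : FormalRep | ∃ N : IntegralRep 2, N.domain = {x | ∀ i, x i ∈ Set.Ioo (0:ℝ) 1} ∧
          EqOn N.integrand (fun x => 4 * x 0 * x 1 / (1 - x 0 ^ 2 * x 1 ^ 2)) N.domain ∧ y = of N} ∪
       {y : FormalRep | ∃ N : IntegralRep 2, N.domain = {x | ∀ i, x i ∈ Set.Ioo (0:ℝ) 1} ∧
          EqOn N.integrand (fun x => 1 / (-1 - x 0 * x 1)) N.domain ∧ y = of N} ∪
       {y : FormalRep | ∃ N : IntegralRep 4, N.domain = {x | ∀ i, x i ∈ Set.Ioo (0:ℝ) 1} ∧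
          EqOn N.integrand (fun x => 1 / (1 - x 0 * x 1 * x 2 * x 3)) N.domain ∧ y = of N} ∪
       {y : FormalRep | ∃ N : IntegralRep 4, N.domain = {x | ∀ i, x i ∈ Set.Ioo (0:ℝ) 1} ∧
          EqOn N.integrand (fun x => 1 / (1 + x 0 * x 1 * x 2 * x 3)) N.domain ∧ y = of N} ∪
       {y : FormalRep | ∃ N : IntegralRep 4, N.domain = {x | ∀ i, x i ∈ Set.Ioo (0:ℝ) 1} ∧
          EqOn N.integrand (fun x => 1 / ((1 - x 0 * x 1) * (1 - x 0 * x 1 * x 2 * x 3))) N.domain ∧ y = of N} ∪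
       {y : FormalRep | ∃ N : IntegralRep 4, N.domain = {x | ∀ i, x i ∈ Set.Ioo (0:ℝ) 1} ∧
          EqOn N.integrand (fun x => 1 / ((1 - x 0 * x 1 * x 2) * (1 - x 0 * x 1 * x 2 * x 3))) N.domain ∧ y = of N} ∪
       {y : FormalRep | ∃ N : IntegralRep 4, N.domain = {x | ∀ i, x i ∈ Set.Ioo (0:ℝ) 1} ∧
          EqOn N.integrand (fun x => 1 / ((1 - x 0 * x 1) * (1 - x 2 * x 3))) N.domain ∧ y = of N} ∪
       {y : FormalRep | ∃ N : IntegralRep 4, N.domain = {x | ∀ i, x i ∈ Set.Ioo (0:ℝ) 1} ∧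
          EqOn N.integrand (fun x => 1 / ((1 - x 0 * x 1) * (1 + x 2 * x 3))) N.domain ∧ y = of N} ∪
       {y : FormalRep | ∃ N : IntegralRep 4, N.domain = {x | ∀ i, x i ∈ Set.Ioo (0:ℝ) 1} ∧
          EqOn N.integrand (fun x => 1 / ((1 + x 0 * x 1) * (1 + x 2 * x 3))) N.domain ∧ y = of N}) ⊔ relations := by
    refine (AddSubgroup.closure_le _).2 ?_
    rintro y (hy | ⟨N, hNd, hNi, rfl⟩)
    · exact AddSubgroup.mem_sup_left (AddSubgroup.subset_closure hy)
    · have e : of N = of W + (of N - of W) := by abel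
      rw [e]
      exact AddSubgroup.add_mem_sup hWmem (hnew N hNd hNi)
  obtain ⟨a, ha, r, hr, rfl⟩ := AddSubgroup.mem_sup.1 (hle hc)
  have hr0 : eval r = 0 := relations_le_ker_eval_holds hr
  have ha0 : eval a = 0 := by rw [map_add, hr0, add_zero] at hv; exact hv
  exact relations.add_mem (piPowers_mem_relations_of_eval_eq_zero ha ha0) hr

end Summit.KontsevichZagierPeriods.HurwitzMicroSectors.NormalFormPrinciple.PiBox.M3
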